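import Literature.Topology.FourManifolds.LeeRasmussen
import Literature.Topology.FourManifolds.Rasmussen
import Literature.Topology.FourManifolds.DehnSurgeryProofs
import Literature.Topology.FourManifolds.SliceRibbon
import HarnessLib

/-!
# Crux `ZseSVanishesOnPairs` contains Rasmussen's slice theorem

Support lemma for crux stmt-SmoothPoincare4-0368 (`s(K') = 0` whenever `K'` is `0`-surgery-equivalent to a
smoothly slice `K`): specialising to `K' = K` and to the `0`-surgery `Y = S³₀(K)`, which exists for every knot
(`Literature.Topology.FourManifolds.exists_isIntegralSurgery_holds`), the crux statement yields the named fact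
`Literature.Topology.FourManifolds.eq_zero_of_isSmoothlySlice` (Rasmussen 2010, Thm. 1: smoothly slice knots
have `s = 0`), which is UNDISCHARGED in the tree (its proof needs the maps induced on Lee homology by link
cobordisms, absent from the tree's knots-only Gauss-diagram complex). Consequence for planning: no proof of the
crux can land before that fact is discharged; every line for this crux is at least Rasmussen-hard formally.
-/

open scoped Manifold ContDiff

namespace Summit.SmoothPoincare4.ZeroSurgeryExotic

open Literature.Topology.FourManifolds

/-- **The crux is at least Rasmussen's theorem.** If `s(K') = 0` for every `0`-surgery pair `(K, K')` with `K`
smoothly slice (the statement of crux `ZseSVanishesOnPairs`, stmt-SmoothPoincare4-0368, spelled out), then every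
smoothly slice knot has `s = 0` (`eq_zero_of_isSmoothlySlice`, Rasmussen 2010, Thm. 1): take `K' = K` and
`Y = S³₀(K)`. [folklore] -/
theorem eq_zero_of_isSmoothlySlice_of_sVanishesOnPairs
    (h : ∀ (K K' : Knot) (Y : Type) [TopologicalSpace Y] [ChartedSpace (EuclideanSpace ℝ (Fin 3)) Y] (s : ℤ),
      IsIntegralSurgery (𝓡 3) Y K 0 → IsIntegralSurgery (𝓡 3) Y K' 0 → K.IsSmoothlySlice →
        K'.HasRasmussenInvariant s → s = 0) :
    eq_zero_of_isSmoothlySlice := by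
  intro K s hs hK
  obtain ⟨Y, _, _, _, _, _, _, hY⟩ := exists_isIntegralSurgery_holds K 0
  exact h K K Y s hY hY hK hs

end Summit.SmoothPoincare4.ZeroSurgeryExotic
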